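import Mathlib
import Summits.ValiantsHypothesis.ValiantsHypothesis.Theorems.NewtonTauWeak.Negative.Zonogon

/-!
# STUB-PLAN sketch for `stub_binomialNewtonTauCommon` (T2) — crux `NewtonTauWeak`, stmt-ValiantsHypothesis-5904

Typed statements of the MERGED plan `STUB-PLAN-stub_binomialNewtonTauCommon.md` (stub-critic, 2026-08-17).
`sorry` bodies only: this file certifies that the new helper lemmas and research targets ELABORATE over existing
declarations.  Everything ideators k1/k2/k3 proposed as provable-now helpers (Davenport / Steinitz normal forms,
THEOREM W, THEOREM G″, graded-design T2) has LANDED meanwhile (lead c6 wave 1: p132606, p133603, p132664, p132495,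
p132656, p132557), so the plan's new typed content is:

* `weightedNormalForm_pinned` (W2′) — the landed normal form with the prefix index PINNED to the Lagrangian spine;
* `kernelBootstrap` (S4) — `V(N,c) ≤ (4N²+5) · V(4c², c)`: the count localises to a `w`-cell-fixed kernel of
  `≤ 4c²` items, so polynomiality in `(N, c)` is decided in the SQUARE REGIME `N ≤ 4c²`;
* the research core in four equivalent-up-to-polynomial typed forms: `WeightedLevelSetPoly` (k3 H6),
  `SquareRegimePoly`, `PureLevelSetPoly` (identical exponent vectors inside each weight class = planar shadows of
  box-bounded partition / knapsack integer hulls; k3 H7 is its instance), `WeightedResiduePoly` (k1 K-A; its pure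
  thick clusters are parametric CYCLIC GROUP knapsacks = shadows of Gomory master corner polyhedra);
* the bookkeeping implications between them.
-/

set_option linter.dupNamespace false
set_option linter.unusedVariables false

noncomputable section

open scoped BigOperators Classical
open MvPolynomial
open Summit.ValiantsHypothesis.ValiantsHypothesis.Theorems.NewtonTauWeak.Negative (vert)

namespace Summit.ValiantsHypothesis.ValiantsHypothesis.Cruxes.NewtonTauWeak.StubPlanBinomialCommon

/-- The lattice embedding used throughout the crux. -/
abbrev emb (e : Fin 2 →₀ ℕ) : Fin 2 → ℝ := fun i => ((e i : ℕ) : ℝ)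

/-- `levelVerts N g d v` = number of hull vertices of the ℤ-weighted level set of subset sums
`X_v = {Σ_{j∈J} d j : Σ_{j∈J} g j = v}` (verbatim the expression of the RungC6 stubs; inline-able by `rfl`). -/
def levelVerts (N : ℕ) (g : Fin N → ℕ) (d : Fin N → (Fin 2 →₀ ℕ)) (v : ℕ) : ℕ :=
  (Set.extremePoints ℝ (convexHull ℝ (emb ''
    (((Finset.univ.filter fun J : Finset (Fin N) => ∑ j ∈ J, g j = v).image
      fun J => ∑ j ∈ J, d j : Finset (Fin 2 →₀ ℕ)) : Set (Fin 2 →₀ ℕ))))).ncard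

/-- `residueVerts N q r g d` = hull vertices of the CYCLICALLY weighted level set `{Σ_J d : Σ_J g ≡ r (mod q)}`
(expression of RungC6 R2 / THEOREM G″). -/
def residueVerts (N q r : ℕ) (g : Fin N → ℕ) (d : Fin N → (Fin 2 →₀ ℕ)) : ℕ :=
  (Set.extremePoints ℝ (convexHull ℝ (emb ''
    (((Finset.univ.filter fun J : Finset (Fin N) => (∑ j ∈ J, g j) % q = r % q).image
      fun J => ∑ j ∈ J, d j : Finset (Fin 2 →₀ ℕ)) : Set (Fin 2 →₀ ℕ))))).ncard

/-! ## Tier 1 — provable now (register as RungC6 wave-3 stubs) -/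

/-- **W2′ (S given the landed W2 proof, p133603) — weighted exchange normal form with the prefix PINNED to the
Lagrangian spine.**  Same data as `RungC6.stub_weightedNormalForm`; the conclusion names the prefix index
`k₀ = the largest k ≤ N whose density prefix has weight ≤ v` instead of `∃ k ≤ N`.  (The landed proof constructs
exactly this `k₀` and then forgets it; S4 below needs it remembered, because only then do all canonical corrections
of one `w`-cell live in one FIXED kernel.) -/
theorem weightedNormalForm_pinned (N c v : ℕ) (g : Fin N → ℕ) (hg : ∀ j, 1 ≤ g j ∧ g j ≤ c)
    (c' : Fin N → ℝ) (J : Finset (Fin N)) (hJ : ∑ j ∈ J, g j = v)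
    (hmax : ∀ J' : Finset (Fin N), ∑ j ∈ J', g j = v → ∑ j ∈ J', c' j ≤ ∑ j ∈ J, c' j)
    (rk : Fin N → ℕ)
    (hrk : ∀ j, rk j = (Finset.univ.filter fun j' : Fin N =>
        c' j * (g j' : ℝ) < c' j' * (g j : ℝ) ∨ (c' j' * (g j : ℝ) = c' j * (g j' : ℝ) ∧ j' < j)).card)
    (canon : ℕ → (ℕ → ℕ) → (ℕ → ℕ) → Finset (Fin N))
    (hcanon : ∀ k α β, canon k α β = Finset.univ.filter fun j : Fin N =>
        (rk j < k ∧ α (g j) ≤ (Finset.univ.filter fun j' : Fin N =>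
            rk j' < k ∧ g j' = g j ∧
              (c' j' * (g j : ℝ) < c' j * (g j' : ℝ) ∨ (c' j * (g j' : ℝ) = c' j' * (g j : ℝ) ∧ j < j'))).card) ∨
        (k ≤ rk j ∧ (Finset.univ.filter fun j' : Fin N =>
            k ≤ rk j' ∧ g j' = g j ∧
              (c' j * (g j' : ℝ) < c' j' * (g j : ℝ) ∨ (c' j' * (g j : ℝ) = c' j * (g j' : ℝ) ∧ j' < j))).card
            < β (g j))) :
    ∃ α β : ℕ → ℕ, (∑ a ∈ Finset.range (c + 1), (α a + β a) ≤ 2 * c) ∧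
      (∀ a, (a = 0 ∨ c < a) → α a = 0 ∧ β a = 0) ∧
      ∑ j ∈ canon (Nat.findGreatest (fun k => ∑ j ∈ (Finset.univ.filter fun j : Fin N => rk j < k), g j ≤ v) N)
          α β, g j = v ∧
      ∑ j ∈ canon (Nat.findGreatest (fun k => ∑ j ∈ (Finset.univ.filter fun j : Fin N => rk j < k), g j ≤ v) N)
          α β, c' j = ∑ j ∈ J, c' j := by
  sorry

/-- **S4 (M) — KERNEL BOOTSTRAP: `V(N, c) ≤ (4N² + 5) · V(4c², c)`.**  If every weighted level set on at most
`4c²` items with weights in `[1, c]` has `≤ B` hull vertices, then every weighted level set on `N` items with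
weights in `[1, c]` has `≤ (4N² + 5) · B` hull vertices — for ARBITRARY exponent lists (coincidences allowed).
Proof: a vertex is strictly exposed by a direction `w` generic for the `N·N` density functionals
`w ↦ ⟨w, g j • d j' − g j' • d j⟩` (`stub_exposedGenericDirection`); inside the open cell of `w` the density order,
hence the spine `P` (W2′) and the KERNEL `L` := (per weight class: the `2c` lowest spine items and the `2c` highest
non-spine items; `|L| ≤ 4c·c`) are constant; by W2′ the maximiser's point is `Σ_{P∖L} d + Σ_S d` with `S ⊆ L` the
(strictly exposed, hence extreme) maximiser of the KERNEL level set `{S ⊆ L : Σ_S g = v − Σ_{P∖L} g}` in direction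
`w`; so `vertex ↦ (cell, kernel vertex)` is injective and `#cells ≤ 4N² + 5` (`ResidueDesignHullAux.signvec_plane_count`).
[k2 STUB-IDEAS §A "bootstrap lemma", sharpened with W1's `2c`; folklore exchange argument] -/
theorem kernelBootstrap (N c v B : ℕ) (g : Fin N → ℕ) (hg : ∀ j, 1 ≤ g j ∧ g j ≤ c)
    (d : Fin N → (Fin 2 →₀ ℕ))
    (hB : ∀ (n v' : ℕ) (g' : Fin n → ℕ) (d' : Fin n → (Fin 2 →₀ ℕ)), n ≤ 4 * c * c →
      (∀ j, 1 ≤ g' j ∧ g' j ≤ c) → levelVerts n g' d' v' ≤ B) :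
    levelVerts N g d v ≤ (4 * (N * N) + 5) * B := by
  sorry

/-! ## Tier 2 — the research core (the stub on level-set designs), four typed forms -/

/-- k3's H6: hull vertices of ℤ-weighted level sets are polynomial in `N` AND the weight bound `c`.
NECESSARY for the stub (level-isolating graded designs, `K = Σ g + 1 ≤ cN + 1`, realise `X_v` as a support:
`RungC6.levelSet_of_T2` = S2 + S3) and SUFFICIENT for T2 on every graded / level-set design of grade `c ≤ poly(KN)`
(`RungC6.stub_gradedDesignT2OfHull`). -/
def WeightedLevelSetPoly : Prop :=
  ∃ e : ℕ, ∀ (N c v : ℕ) (g : Fin N → ℕ), (∀ j, 1 ≤ g j ∧ g j ≤ c) → ∀ d : Fin N → (Fin 2 →₀ ℕ),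
    levelVerts N g d v ≤ (c * N + 2) ^ e

/-- The SQUARE REGIME: the same statement only for `N ≤ 4c²` items. -/
def SquareRegimePoly : Prop :=
  ∃ e : ℕ, ∀ (N c v : ℕ) (g : Fin N → ℕ), N ≤ 4 * c * c → (∀ j, 1 ≤ g j ∧ g j ≤ c) →
    ∀ d : Fin N → (Fin 2 →₀ ℕ), levelVerts N g d v ≤ (c + 2) ^ e

/-- **S5 (S, from S4) — polynomiality is decided in the square regime.** (`(4N²+5)(c+2)^e ≤ (cN+2)^{e+4}` for
`N, c ≥ 1`; `N = 0` or `c = 0` are degenerate: at most one point.) -/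
theorem weightedLevelSetPoly_of_square (h : SquareRegimePoly) : WeightedLevelSetPoly := by
  sorry

/-- Trivial converse. -/
theorem square_of_weightedLevelSetPoly (h : WeightedLevelSetPoly) : SquareRegimePoly := by
  sorry

/-- PURE level sets: `c` weight classes, class `a` = `m a` items of weight `a + 1` with the SAME exponent vector
`D a`; the level set is the planar shadow `n ↦ Σ_a n_a • D_a` of the lattice points of the box-bounded knapsack
slice `{0 ≤ n ≤ m, Σ_a (a+1) n_a = v}`; its hull edges are primitive partition identities (Graver moves of
`(1, 2, …, c)`, Diaconis–Graham–Sturmfels 1993), and near each vertex of the LP shadow polygon (`O(c²)` of them: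
density order of the classes) the cluster of integer vertices is, when the boundary class is thick, the breakpoint
set of a parametric CYCLIC GROUP knapsack in `ℤ/(boundary weight)` (STUB-PLAN §3).  k3's `PartitionShadowPoly` is
the instance `c = v = n`, `m ≡ n`. -/
def PureLevelSetPoly : Prop :=
  ∃ e : ℕ, ∀ (c v : ℕ) (m : Fin c → ℕ) (D : Fin c → (Fin 2 →₀ ℕ)),
    (Set.extremePoints ℝ (convexHull ℝ (emb ''
      ((((Fintype.piFinset fun a : Fin c => Finset.range (m a + 1)).filter
          fun n : Fin c → ℕ => ∑ a : Fin c, ((a : ℕ) + 1) * n a = v).image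
        fun n => ∑ a : Fin c, n a • D a : Finset (Fin 2 →₀ ℕ)) : Set (Fin 2 →₀ ℕ))))).ncard ≤
      (c * ∑ a, m a + 2) ^ e

/-- **S7 (S/M, bookkeeping) — pure level sets are weighted level sets** (items `Σ_a m_a`, item `(a, i)` of weight
`a + 1` and exponent `D a`; subsets with the same class counts have the same point). -/
theorem pureLevelSetPoly_of_weighted (h : WeightedLevelSetPoly) : PureLevelSetPoly := by
  sorry

/-- k1's K-A in `ℕ`-valued form: CYCLICALLY weighted level sets (weighted residue designs, `K = q` products on a
dissociated list) are polynomial in `N` and `q`.  THEOREM G″ (landed, R1 + R2) gives `(4(N²+N)+5)·q^{2q}`. -/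
def WeightedResiduePoly : Prop :=
  ∃ e : ℕ, ∀ (N q r : ℕ) (g : Fin N → ℕ) (d : Fin N → (Fin 2 →₀ ℕ)), 1 ≤ q → (∀ j, d j ≠ 0) →
    residueVerts N q r g d ≤ (N * q + 2) ^ e

/-- **S8 (S, bookkeeping) — cyclic ⇒ integral**: a ℤ-level set with weights `≤ c` on `N` items is the residue
level set modulo any `q > cN` (weights `< q`, sums `< q`); exponents may be assumed nonzero by the scale
refinement of S3 (`stub_refineDissociate`: `d' j = M • d j + single 0 2^j ≠ 0` never lowers the count; directly, a
zero-exponent item merges the two LEVELS `v`, `v - g j` of the other items, costing a factor `≤ cN + 1` by the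
union bound).  So `WeightedResiduePoly → WeightedLevelSetPoly` (with
`q = cN + 1`: `(N(cN+1)+2)^e ≤ (cN+2)^{2e}`), and conversely `WeightedLevelSetPoly` bounds each of the `≤ N`
integral levels `r, r+q, …` whose union is the residue set: the two research targets are equivalent up to the
exponent. Stated here in the direction the kill switch uses. -/
theorem weightedLevelSetPoly_of_residue (h : WeightedResiduePoly) : WeightedLevelSetPoly := by
  sorry

/-! ## The kill switch (landed modulo the in-flight stubs S2 `stub_levelSetOfT2`, S3 `stub_refineDissociate`):
`RungC6.levelSet_of_T2 : T2(b) → levelVerts N g d v ≤ ((Σ g + 1)·N + 2)^b` for EVERY exponent list — so an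
explicit family of weighted level sets with super-polynomially many hull vertices refutes the stub (and KPTT
Conj. 1 in its printed polynomial form).  Sanity: the stub, verbatim. -/
example : Prop :=
  ∃ b : ℕ, ∀ (K N : ℕ) (c : Fin K → ℂ) (ρ : Fin K → Fin N → ℂ) (d : Fin N → (Fin 2 →₀ ℕ)),
    vert (∑ l, C (c l) * ∏ j, (1 - C (ρ l j) * monomial (d j) 1)) ≤ (K * N + 2) ^ b

end Summit.ValiantsHypothesis.ValiantsHypothesis.Cruxes.NewtonTauWeak.StubPlanBinomialCommon

end
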